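import Mathlib
import Summits.Ventures.PercRepro2.Defs
import Summits.Ventures.PercRepro2.Harris
import Summits.Ventures.PercRepro2.Graph
import Summits.Ventures.PercRepro2.Events
import Summits.Ventures.PercRepro2.MixedBoxDefs
import Summits.Ventures.PercRepro2.ReachClosure
import Summits.Ventures.PercRepro2.ReachBits
import Summits.Ventures.PercRepro2.CellMonoRefutation
import Summits.Ventures.PercRepro2.BlockFamilyCorollary

/-!
# The four-vertex log-supermodular pair `(NNNS, NSSN)` is FALSE: a kernel-checked refutation
(blind cell PercRepro2, mine-1 g53; proofs/MINE1-BLOCKS.md §2.5(d), MINE-1.md §70)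

Of g51's four four-vertex survivors of the log-supermodular-pair census, two are theorems
(`BlockFamilyCorollary.lean`: the block family); `NNNS·NSSN ≤ NSSS·NNNN` on `(x₁, x₂, x₃, x₄)`
is, in the box `{x₁ ∈ N}`, the DOUBLED form (`x₂, x₃` in place of one vertex) of the pair
`(N;N,S)·(N;S,N) ≤ (N;S,S)·(N;N,N)` that `LSMPairRefutation.lean` refutes — and a pendant
vertex reduces the one to the other: with `x₃` hanging on `x₂` by an edge of weight `q`,
`m(NNNS) = m(NNS)`, `m(NSSN) = q·m(NSN)`, `m(NSSS) = q·m(NSS)`, `m(NNNN) = m(NNN)`, so the defect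
of the doubled pair is `q` times the defect of the undoubled one.

THE WITNESS: g51's graph with the pendant — eight vertices, the nine edges
`4–6, 4–5, 2–5, 3–0, 0–4, 3–4, 2–3, 3–1, 1–7` with weights
`4095/4096, 1/2, 1/2, 255/256, 4095/4096, 1/2, 1/2, 1/2, 1/2`; roots `s = 2`, `t = 0`; observed
`(x₁, x₂, x₃, x₄) = (6, 1, 7, 5)`.  Over the `2⁹` configurations, with the integer weight
`wt(ω) = ∏_e (num_e if e open else den_e − num_e)` and `D = ∏_e den_e = 2³⁸`:
`m(NNNS) = 6340614`, `m(NSSN) = 12288`, `m(NSSS) = 8196`, `m(NNNN) = 8470012` (units of `2⁻³⁸`),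
so `m(NSSS) m(NNNN) − m(NNNS) m(NSSN) = −8493246480 < 0` — exactly `−530827905 / 2⁷²` in
probability units.  The masses are decided by the kernel with the bitmask reachability of
`ReachBits` (`CellMonoRefutation.statusF`, `decConnB`); standard axioms.
-/

namespace Summit.Ventures.PercRepro2

namespace BlockFamily

open MixedBox CellMonoRefutation

section Fast

variable {n : ℕ} {E : Type*} [Fintype E] [DecidableEq E]

/-- `s ↔ t` decided through the bitmask closure. -/
def connF (ends : E → Sym2 (Fin n)) (ω : Config E) (s t : Fin n) : Bool :=
  @decide (Conn ends ω s t) (decConnB ends ω s t)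

omit [DecidableEq E] in
/-- The bitmask decision of `s ↔ t` agrees with `Conn`. -/
lemma connF_eq_true_iff (ends : E → Sym2 (Fin n)) (ω : Config E) (s t : Fin n) :
    connF ends ω s t = true ↔ Conn ends ω s t := by
  unfold connF
  exact @decide_eq_true_iff _ (decConnB ends ω s t)

/-- Fast membership in `cell4`. -/
instance instDecCell4F (ends : E → Sym2 (Fin n)) (s t x₁ x₂ x₃ x₄ : Fin n)
    (c : Fin 3 × Fin 3 × Fin 3 × Fin 3) : DecidablePred (· ∈ cell4 ends s t x₁ x₂ x₃ x₄ c) :=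
  fun ω => decidable_of_iff
    (statusF ends s t x₁ ω = c.1 ∧ statusF ends s t x₂ ω = c.2.1 ∧
      statusF ends s t x₃ ω = c.2.2.1 ∧ statusF ends s t x₄ ω = c.2.2.2 ∧
        ¬ connF ends ω s t = true)
    (by simp only [cell4, Set.mem_setOf_eq, status_eq_statusF, connF_eq_true_iff])

end Fast

section Witness

/-- The nine edges of the witness graph on eight vertices: g51's refuting graph
`4–6, 4–5, 2–5, 3–0, 0–4, 3–4, 2–3, 3–1` with the pendant `1–7`. -/
def ends9 : Fin 9 → Sym2 (Fin 8) :=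
  ![s(4, 6), s(4, 5), s(2, 5), s(3, 0), s(0, 4), s(3, 4), s(2, 3), s(3, 1), s(1, 7)]

/-- Numerators of the edge weights. -/
def num9 : Fin 9 → ℕ := ![4095, 1, 1, 255, 4095, 1, 1, 1, 1]

/-- Denominators of the edge weights. -/
def den9 : Fin 9 → ℕ := ![4096, 2, 2, 256, 4096, 2, 2, 2, 2]

/-- The edge weights `4095/4096, 1/2, 1/2, 255/256, 4095/4096, 1/2, 1/2, 1/2, 1/2`. -/
def p9 : Fin 9 → ℚ := fun e => (num9 e : ℚ) / den9 e

/-- The integer weight of a configuration: `∏_e (num_e if open else den_e − num_e)`. -/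
def wt9 : Config (Fin 9) → ℕ := fun ω => ∏ e, if ω e then num9 e else den9 e - num9 e

/-- The weights are admissible. -/
lemma p9_isProbVec : IsProbVec p9 :=
  ⟨fun e => by fin_cases e <;> norm_num [p9, num9, den9],
   fun e => by fin_cases e <;> norm_num [p9, num9, den9]⟩

/-- `weight p9 ω = wt9 ω / 2³⁸`. -/
lemma p9_weight_eq (ω : Config (Fin 9)) : weight p9 ω = (wt9 ω : ℚ) / 2 ^ 38 := by
  unfold weight wt9
  have hD : (2 : ℚ) ^ 38 = ∏ e : Fin 9, (den9 e : ℚ) := by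
    simp [Fin.prod_univ_succ, den9]; norm_num
  rw [Nat.cast_prod, hD, ← Finset.prod_div_distrib]
  refine Finset.prod_congr rfl fun e _ => ?_
  fin_cases e <;> cases ω _ <;> norm_num [edgeFactor, p9, num9, den9]

/-- Configurations on nine edges as the numbers below `2⁹`. -/
def e9 : Config (Fin 9) ≃ Fin (2 ^ 9) :=
  (Equiv.piCongrRight fun _ => finTwoEquiv.symm).trans finFunctionFinEquiv

/-- The configuration with bit pattern `k`. -/
def cfg9 (k : Fin (2 ^ 9)) : Config (Fin 9) := e9.symm k

/-- A mass on nine edges as a sum over the `2⁹` bit patterns. -/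
lemma mass_eq_sum9 (wt : Config (Fin 9) → ℕ) (A : Set (Config (Fin 9))) [DecidablePred (· ∈ A)] :
    mass wt A = ∑ k : Fin (2 ^ 9), if cfg9 k ∈ A then wt (cfg9 k) else 0 := by
  rw [mass, Finset.sum_filter]
  exact Fintype.sum_equiv e9 _ _ (fun ω => by simp [cfg9])

/-- The cell `(N, N, N, S)`. -/
def cNNNS : Fin 3 × Fin 3 × Fin 3 × Fin 3 := (1, 1, 1, 2)
/-- The cell `(N, S, S, N)`. -/
def cNSSN : Fin 3 × Fin 3 × Fin 3 × Fin 3 := (1, 2, 2, 1)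

set_option maxRecDepth 100000 in
set_option maxHeartbeats 8000000 in
/-- The integer masses of the witness (roots `2, 0`, observed `6, 1, 7, 5`):
`m(NSSS) · m(NNNN) < m(NNNS) · m(NSSN)`. -/
theorem mass_NNNS_NSSN :
    mass wt9 (cell4 ends9 2 0 6 1 7 5 (cellJoin4 cNNNS cNSSN)) *
        mass wt9 (cell4 ends9 2 0 6 1 7 5 (cellMeet4 cNNNS cNSSN)) <
      mass wt9 (cell4 ends9 2 0 6 1 7 5 cNNNS) * mass wt9 (cell4 ends9 2 0 6 1 7 5 cNSSN) := by
  rw [mass_eq_sum9, mass_eq_sum9, mass_eq_sum9, mass_eq_sum9]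
  decide +kernel

/-- **Refutation glue**: integer masses with `m(a∨b) m(a∧b) < m(a) m(b)` (all on `{s ↮ t}`) refute
`LSMPair4 a b`. -/
theorem not_lsmPair4_of_mass {n : ℕ} {E : Type} [Fintype E] [DecidableEq E]
    {p : E → ℚ} (hp : IsProbVec p) (ends : E → Sym2 (Fin n)) (s t x₁ x₂ x₃ x₄ : Fin n)
    {wt : Config E → ℕ} {D : ℚ} (hD : 0 < D) (hw : ∀ ω, weight p ω = (wt ω : ℚ) / D)
    (a b : Fin 3 × Fin 3 × Fin 3 × Fin 3)
    (hm : mass wt (cell4 ends s t x₁ x₂ x₃ x₄ (cellJoin4 a b)) *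
            mass wt (cell4 ends s t x₁ x₂ x₃ x₄ (cellMeet4 a b)) <
          mass wt (cell4 ends s t x₁ x₂ x₃ x₄ a) * mass wt (cell4 ends s t x₁ x₂ x₃ x₄ b)) :
    ¬ LSMPair4 a b := by
  intro h
  have key := h (Fin n) E p hp ends s t x₁ x₂ x₃ x₄
  rw [prob_eq_mass_div hw, prob_eq_mass_div hw, prob_eq_mass_div hw, prob_eq_mass_div hw,
    div_mul_div_comm, div_mul_div_comm] at key
  have hDD : (0 : ℚ) < D * D := by positivity
  have key' := mul_le_mul_of_nonneg_right key hDD.le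
  rw [div_mul_cancel₀ _ hDD.ne', div_mul_cancel₀ _ hDD.ne'] at key'
  norm_cast at key'
  exact absurd key' (not_le.mpr hm)

set_option maxRecDepth 100000 in
set_option maxHeartbeats 1000000 in
/-- **The four-vertex pair `(NNNS, NSSN)` is false**: `m(NNNS) m(NSSN) ≤ m(NSSS) m(NNNN)` fails —
the doubled form of the refuted pair `(NNS, NSN)` is refuted by the same graph with a pendant. -/
theorem not_lsmPair4_NNNS_NSSN : ¬ LSMPair4 cNNNS cNSSN :=
  not_lsmPair4_of_mass (wt := wt9) (D := 2 ^ 38) p9_isProbVec ends9 2 0 6 1 7 5 (by norm_num)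
    p9_weight_eq cNNNS cNSSN mass_NNNS_NSSN

end Witness

end BlockFamily

end Summit.Ventures.PercRepro2
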